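import Mathlib.Analysis.Convex.Hull
import Mathlib.Algebra.Polynomial.Roots
import Mathlib.LinearAlgebra.Matrix.DotProduct
import Mathlib.LinearAlgebra.CrossProduct
import Mathlib.Analysis.Complex.Basic
import HarnessLib

/-!
# Kishimoto–Yoneda, §§3–4: generic linear functionals and exposed points of a finite set

Support file for `FiniteFourierModeEuler` (N. Kishimoto, T. Yoneda, J. Math. Fluid Mech. 24
(2022) 74 = arXiv:2110.08039). The convex-geometric steps of §3 and §4 ("let `f` be the linear
functional with `f ≡ 1` on `E`", "vertices of `S^{conv}`", "we can find a linear functional `g`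
with `g ≡ 0` on `E` and `g > 0` on `F ∖ E`") are carried out in this formalisation with linear
functionals `x ↦ w · x` on finite subsets of `ℝ³`. This file PROVES the two generic-position tools:

* `exists_forall_dot_ne_zero`: for finitely many non-zero vectors there is a direction `w` not
  orthogonal to any of them (the moment curve `t ↦ (1, t, t²)` meets each hyperplane in at most
  two parameters); hence (`exists_dot_injOn`) a functional injective on a given finite set, and
  (`exists_strict_argmax`) a unique maximiser of it;
* `not_mem_openSegment_of_exposed` / `eq_of_exposed_of_convex_comb`: a point of `S` at which some
  functional is STRICTLY maximal (an exposed vertex of `S^{conv}`) is not a non-trivial convex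
  combination of a point of `S` and a point of the convex hull of `S` (the fact behind "which is
  a contradiction" at the end of the proof of Prop. 4.8), via `dot_le_of_mem_convexHull`
  (a linear functional is bounded on `conv S` by its maximum on `S`).

## References

* [KishimotoYoneda2022] N. Kishimoto, T. Yoneda, J. Math. Fluid Mech. 24 (2022) 74 =
  arXiv:2110.08039, §3 (proof of Prop. 3.1 (i)), §4 (proofs of Lemma 4.5 and Prop. 4.8).
-/

noncomputable section

open Matrix Finset Polynomial

namespace Literature.Analysis.FluidPDE

namespace KY

/-! ### A direction in general position -/

/-- The moment-curve functional `(1, t, t²)`. [folklore] -/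
theorem momentVec_dot (t : ℝ) (v : Fin 3 → ℝ) :
    (![1, t, t ^ 2] : Fin 3 → ℝ) ⬝ᵥ v = v 0 + v 1 * t + v 2 * t ^ 2 := by
  simp [dotProduct, Fin.sum_univ_three]; ring

/-- **A direction not orthogonal to finitely many non-zero vectors.** [folklore] -/
theorem exists_forall_dot_ne_zero (D : Finset (Fin 3 → ℝ)) (hD : ∀ v ∈ D, v ≠ 0) :
    ∃ w : Fin 3 → ℝ, ∀ v ∈ D, w ⬝ᵥ v ≠ 0 := by
  classical
  -- the polynomial `v₀ + v₁ T + v₂ T²` is non-zero for `v ≠ 0`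
  let P : (Fin 3 → ℝ) → ℝ[X] := fun v => C (v 0) + C (v 1) * X + C (v 2) * X ^ 2
  have hP : ∀ v ∈ D, P v ≠ 0 := by
    intro v hv h0
    apply hD v hv
    have h0' : ∀ k, (P v).coeff k = 0 := fun k => by rw [h0, coeff_zero]
    have c0 := h0' 0
    have c1 := h0' 1
    have c2 := h0' 2
    simp only [P, coeff_add, coeff_C, coeff_C_mul, coeff_X, coeff_X_pow] at c0 c1 c2
    norm_num at c0 c1 c2
    ext i; fin_cases i
    · exact c0
    · exact c1
    · exact c2
  have heval : ∀ v t, (P v).eval t = (![1, t, t ^ 2] : Fin 3 → ℝ) ⬝ᵥ v := by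
    intro v t
    simp only [P, eval_add, eval_mul, eval_C, eval_X, eval_pow, momentVec_dot]
  -- avoid the finitely many roots
  let bad : Finset ℝ := D.biUnion fun v => (P v).roots.toFinset
  obtain ⟨t, ht⟩ := Infinite.exists_notMem_finset bad
  refine ⟨![1, t, t ^ 2], fun v hv h0 => ht ?_⟩
  refine Finset.mem_biUnion.2 ⟨v, hv, ?_⟩
  rw [Multiset.mem_toFinset, mem_roots (hP v hv), IsRoot.def, heval, h0]

/-- **A functional injective on a finite set** ("let `g` be generic"). [folklore] -/
theorem exists_dot_injOn (T : Finset (Fin 3 → ℝ)) :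
    ∃ w : Fin 3 → ℝ, ∀ x ∈ T, ∀ y ∈ T, w ⬝ᵥ x = w ⬝ᵥ y → x = y := by
  classical
  let D : Finset (Fin 3 → ℝ) := ((T ×ˢ T).filter fun q => q.1 ≠ q.2).image fun q => q.1 - q.2
  have hD : ∀ v ∈ D, v ≠ 0 := by
    intro v hv
    obtain ⟨q, hq, rfl⟩ := Finset.mem_image.1 hv
    exact sub_ne_zero.2 (Finset.mem_filter.1 hq).2
  obtain ⟨w, hw⟩ := exists_forall_dot_ne_zero D hD
  refine ⟨w, fun x hx y hy hxy => ?_⟩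
  by_contra hne
  have hmem : x - y ∈ D :=
    Finset.mem_image.2 ⟨(x, y), Finset.mem_filter.2 ⟨Finset.mem_product.2 ⟨hx, hy⟩, hne⟩, rfl⟩
  exact hw _ hmem (by rw [dotProduct_sub, hxy, sub_self])

/-- A generic functional together with a prescribed finite set of non-orthogonality conditions.
[folklore] -/
theorem exists_dot_injOn_and_ne (T : Finset (Fin 3 → ℝ)) (D : Finset (Fin 3 → ℝ))
    (hD : ∀ v ∈ D, v ≠ 0) :
    ∃ w : Fin 3 → ℝ, (∀ x ∈ T, ∀ y ∈ T, w ⬝ᵥ x = w ⬝ᵥ y → x = y) ∧ ∀ v ∈ D, w ⬝ᵥ v ≠ 0 := by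
  classical
  let D' : Finset (Fin 3 → ℝ) :=
    (((T ×ˢ T).filter fun q => q.1 ≠ q.2).image fun q => q.1 - q.2) ∪ D
  have hD' : ∀ v ∈ D', v ≠ 0 := by
    intro v hv
    rcases Finset.mem_union.1 hv with h | h
    · obtain ⟨q, hq, rfl⟩ := Finset.mem_image.1 h
      exact sub_ne_zero.2 (Finset.mem_filter.1 hq).2
    · exact hD v h
  obtain ⟨w, hw⟩ := exists_forall_dot_ne_zero D' hD'
  refine ⟨w, fun x hx y hy hxy => ?_, fun v hv => hw v (Finset.mem_union_right _ hv)⟩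
  by_contra hne
  have hmem : x - y ∈ D' := Finset.mem_union_left _
    (Finset.mem_image.2 ⟨(x, y), Finset.mem_filter.2 ⟨Finset.mem_product.2 ⟨hx, hy⟩, hne⟩, rfl⟩)
  exact hw _ hmem (by rw [dotProduct_sub, hxy, sub_self])

/-- **The strict maximiser of an injective functional on a non-empty finite set.** [folklore] -/
theorem exists_strict_argmax {T : Finset (Fin 3 → ℝ)} (hT : T.Nonempty) {w : Fin 3 → ℝ}
    (hw : ∀ x ∈ T, ∀ y ∈ T, w ⬝ᵥ x = w ⬝ᵥ y → x = y) :
    ∃ x ∈ T, ∀ y ∈ T, y ≠ x → w ⬝ᵥ y < w ⬝ᵥ x := by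
  obtain ⟨x, hx, hmax⟩ := T.exists_max_image (fun y => w ⬝ᵥ y) hT
  refine ⟨x, hx, fun y hy hne => lt_of_le_of_ne (hmax y hy) fun h => hne (hw y hy x hx h)⟩

/-! ### Linear functionals on the convex hull; exposed points -/

/-- A linear functional is bounded on `conv S` by any bound valid on `S`. [folklore] -/
theorem dot_le_of_mem_convexHull {S : Set (Fin 3 → ℝ)} {w : Fin 3 → ℝ} {M : ℝ}
    (hM : ∀ s ∈ S, w ⬝ᵥ s ≤ M) {x : Fin 3 → ℝ} (hx : x ∈ convexHull ℝ S) : w ⬝ᵥ x ≤ M := by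
  have hconv : Convex ℝ {y : Fin 3 → ℝ | w ⬝ᵥ y ≤ M} := by
    intro y hy z hz a b ha hb hab
    simp only [Set.mem_setOf_eq] at hy hz ⊢
    rw [dotProduct_add, dotProduct_smul, dotProduct_smul, smul_eq_mul, smul_eq_mul]
    have h1 : a * (w ⬝ᵥ y) ≤ a * M := mul_le_mul_of_nonneg_left hy ha
    have h2 : b * (w ⬝ᵥ z) ≤ b * M := mul_le_mul_of_nonneg_left hz hb
    have h3 : a * M + b * M = M := by rw [← add_mul, hab, one_mul]
    linarith
  exact (convexHull_min (fun s hs => hM s hs) hconv) hx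

/-- **An exposed point of `S` is not a non-trivial convex combination** of a point of `S` and a
point of `conv S`: if `w · v > w · s` for all `s ∈ S ∖ {v}` and `v = (1 - q) b + q a` with
`b ∈ S`, `a ∈ conv S`, `0 < q < 1`, then `a = b (= v)`. This is the contradiction closing the
proof of Prop. 4.8 ("which is a contradiction"), in the form used in this formalisation.
[cite: KishimotoYoneda2022, §4 proof of Prop. 4.8] -/
theorem eq_of_exposed_of_convex_comb {S : Finset (Fin 3 → ℝ)} {w v a b : Fin 3 → ℝ} {q : ℝ}
    (hv : v ∈ S) (hexp : ∀ s ∈ S, s ≠ v → w ⬝ᵥ s < w ⬝ᵥ v) (hb : b ∈ S)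
    (ha : a ∈ convexHull ℝ (S : Set (Fin 3 → ℝ))) (hq0 : 0 < q) (hq1 : q < 1)
    (hcomb : v = (1 - q) • b + q • a) : a = b := by
  have hM : ∀ s ∈ (S : Set (Fin 3 → ℝ)), w ⬝ᵥ s ≤ w ⬝ᵥ v := by
    intro s hs
    by_cases h : s = v
    · rw [h]
    · exact (hexp s hs h).le
  have ha' : w ⬝ᵥ a ≤ w ⬝ᵥ v := dot_le_of_mem_convexHull hM ha
  have hb' : w ⬝ᵥ b ≤ w ⬝ᵥ v := hM b hb
  have hvw : w ⬝ᵥ v = (1 - q) * (w ⬝ᵥ b) + q * (w ⬝ᵥ a) := by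
    conv_lhs => rw [hcomb]
    rw [dotProduct_add, dotProduct_smul, dotProduct_smul, smul_eq_mul, smul_eq_mul]
  -- both inequalities are equalities
  have hbeq : w ⬝ᵥ b = w ⬝ᵥ v := by nlinarith
  have hbv : b = v := by
    by_contra h; exact (hexp b hb h).ne hbeq
  subst hbv
  -- then `q • a = q • b`
  have : q • a = q • b := by
    have h2 : b = (1 - q) • b + q • a := hcomb
    have h3 : q • b = q • a := by
      calc q • b = b - (1 - q) • b := by rw [sub_smul, one_smul, sub_sub_cancel]
        _ = q • a := by nth_rewrite 1 [h2]; abel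
    exact h3.symm
  exact smul_right_injective _ hq0.ne' this

end KY

end Literature.Analysis.FluidPDE
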